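import Mathlib
import Summits.AtomisticToContinuum.FouriersLaw.Theorems.EmbeddedDrudeMourreKineticConductivityFiniteAlgebra
import HarnessLib

/-!
# Transversality of the collision sheet on the exchange planes — `stub_planeTransversal` (stub TB) of line `swap-odd-threshold-rigidity`
(crux `EmbeddedDrudeMourre.MourreDissolution`, item stmt-AtomisticToContinuum-12594; helper file, `--supports`)

Registered stub TB of the checked skeleton of line `swap-odd-threshold-rigidity` (lead c8), in the
skeleton's stub namespace `Summit.AtomisticToContinuum.FouriersLaw.Theorems.MourreDissolution`.

Notation: `ω(k) = √(ω₂ + 2(1 − cos k))` (`PhononBoltzmann.dispersion`, `ω₂ > 0`), `v(k) = sin k/ω(k)`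
(`groupVelocity`), `Ω₀ = ω₂ + 2`, `ωⱼ = ω(kⱼ)`, `vⱼ = v(kⱼ)`, `k₄ = k₁ + k₂ − k₃`, and
  `H = (ω₁ω₂ + ω₃ω₄ + 2Ω₀) cos((k₁+k₂)/2) − 4 cos((k₃−k₁)/2) cos((k₂−k₃)/2)` (the collision sheet),
  `G = (ω₁v₂ + ω₃v₄) cos((k₁+k₂)/2) − ½(ω₁ω₂ + ω₃ω₄ + 2Ω₀) sin((k₁+k₂)/2) + 2cos((k₃−k₁)/2) sin((k₂−k₃)/2)`
(`= ∂H/∂k₂`, not used). CLAIM: `H = 0 ∧ sin((k₃−k₁)/2) sin((k₂−k₃)/2) = 0 ⟹ G ≠ 0`.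

Proof. A shift by `2p` with `sin p = 0` does not change `cos`, `sin`, `ω`, `v`, and a shift by `p`
multiplies `cos`, `sin` by `cos p = ±1` (§1); this reduces the two exchange planes to two-variable
statements (no bookkeeping of the integer `n` in `k₃ = k₁ + 2nπ` is needed):
* on `sin((k₃−k₁)/2) = 0`: `H = (2ω₁ω₂ + 2Ω₀) cos A − 4 cos B`, `G = 2ω₁v₂ cos A − (ω₁ω₂+Ω₀) sin A + 2 sin B`
  with `A = (k₁+k₂)/2`, `B = (k₂−k₁)/2` (`planeTransversal_exch₁₃`);
* on `sin((k₂−k₃)/2) = 0`: `H = ±[(2ω₁ω₃ + 2Ω₀) cos A′ − 4 cos B′]`,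
  `G = ±[(ω₁v₃ + ω₃v₁) cos A′ − (ω₁ω₃+Ω₀) sin A′]`, `A′ = (k₁+k₃)/2`, `B′ = (k₃−k₁)/2`
  (`planeTransversal_exch₂₃`).
The PLANE IDENTITY (§2, pure algebra from `ω² = Ω₀ − 2cos k`)
  `sin B · [(2ω₁ω₂ + 2Ω₀) cos A − 4 cos B] = (ω₁ sin k₂ − ω₂ sin k₁)(ω₁ + ω₂)`
shows that a zero of the reduced `H` has equal velocities, `ω₁ sin k₂ = ω₂ sin k₁`. Then (§3)
* case `k₂ ≡ k₃`: `G = ±sin A′ (2cos A′ cos B′ − ω₁ω₃ − Ω₀)` with `2cos A′ cos B′ = cos k₁ + cos k₃ ≤ 2 < ω₁ω₃ + Ω₀`,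
  so `G = 0` forces `sin A′ = 0`, `cos² A′ = 1`, and then `H = 0` reads `(ω₁ω₃ + Ω₀)² = 4cos² B′ ≤ 4` —
  contradiction (this covers the triple diagonal `k₃ ≡ k₁` too);
* case `k₃ ≡ k₁`, `k₂ ≢ k₁`: `2 sin B · G = (cos k₁ − cos k₂)(2cos k₁ − ω₁ω₂ − Ω₀)`; the second factor is
  `< 0`, and `cos k₁ = cos k₂` together with `ω₁ sin k₂ = ω₂ sin k₁` gives `sin k₁ = sin k₂`, i.e.
  `2 sin² B = 1 − cos(k₂ − k₁) = 0` — contradiction; on `k₃ ≡ k₁ ≡ k₂` the claim is the first case.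
Pure algebra/trigonometry; no cited facts.
-/

noncomputable section

namespace Summit.AtomisticToContinuum.FouriersLaw.Theorems.MourreDissolution

open Literature.MathematicalPhysics.KineticTheory
open Literature.MathematicalPhysics.KineticTheory.PhononBoltzmann
open Summit.AtomisticToContinuum.FouriersLaw.Theorems.KineticConductivityFinite

/-! ### 1. Shifts by `p` and `2p` when `sin p = 0` -/

/-- If `sin p = 0` then `cos² p = 1`. [folklore] -/
theorem planeTransversal_cos_sq {p : ℝ} (hp : Real.sin p = 0) : Real.cos p ^ 2 = 1 := by
  rw [Real.cos_sq', hp]; ring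

/-- If `sin p = 0` then `cos p ≠ 0`. [folklore] -/
theorem planeTransversal_cos_ne_zero {p : ℝ} (hp : Real.sin p = 0) : Real.cos p ≠ 0 := by
  intro h
  have h2 := planeTransversal_cos_sq hp
  rw [h] at h2
  norm_num at h2

/-- If `sin p = 0` then `cos (2p) = 1`. [folklore] -/
theorem planeTransversal_cos_two_mul {p : ℝ} (hp : Real.sin p = 0) : Real.cos (2 * p) = 1 := by
  rw [Real.cos_two_mul, planeTransversal_cos_sq hp]; ring

/-- If `sin p = 0` then `sin (2p) = 0`. [folklore] -/
theorem planeTransversal_sin_two_mul {p : ℝ} (hp : Real.sin p = 0) : Real.sin (2 * p) = 0 := by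
  rw [Real.sin_two_mul, hp]; ring

/-- If `sin p = 0` then `cos (x + 2p) = cos x`. [folklore] -/
theorem planeTransversal_cos_add_two_mul {p : ℝ} (hp : Real.sin p = 0) (x : ℝ) :
    Real.cos (x + 2 * p) = Real.cos x := by
  rw [Real.cos_add, planeTransversal_cos_two_mul hp, planeTransversal_sin_two_mul hp]; ring

/-- If `sin p = 0` then `sin (x + 2p) = sin x`. [folklore] -/
theorem planeTransversal_sin_add_two_mul {p : ℝ} (hp : Real.sin p = 0) (x : ℝ) :
    Real.sin (x + 2 * p) = Real.sin x := by
  rw [Real.sin_add, planeTransversal_cos_two_mul hp, planeTransversal_sin_two_mul hp]; ring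

/-- If `sin p = 0` then `cos (x + p) = cos x · cos p`. [folklore] -/
theorem planeTransversal_cos_add {p : ℝ} (hp : Real.sin p = 0) (x : ℝ) :
    Real.cos (x + p) = Real.cos x * Real.cos p := by
  rw [Real.cos_add, hp]; ring

/-- If `sin p = 0` then `sin (x + p) = sin x · cos p`. [folklore] -/
theorem planeTransversal_sin_add {p : ℝ} (hp : Real.sin p = 0) (x : ℝ) :
    Real.sin (x + p) = Real.sin x * Real.cos p := by
  rw [Real.sin_add, hp]; ring

/-- If `sin p = 0` then `ω(x + 2p) = ω(x)`. [folklore] -/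
theorem planeTransversal_dispersion_add {p : ℝ} (hp : Real.sin p = 0) (ω₂ x : ℝ) :
    dispersion ω₂ (x + 2 * p) = dispersion ω₂ x := by
  unfold dispersion
  rw [planeTransversal_cos_add_two_mul hp]

/-- If `sin p = 0` then `v(x + 2p) = v(x)`. [folklore] -/
theorem planeTransversal_groupVelocity_add {p : ℝ} (hp : Real.sin p = 0) (ω₂ x : ℝ) :
    groupVelocity ω₂ (x + 2 * p) = groupVelocity ω₂ x := by
  unfold groupVelocity
  rw [planeTransversal_sin_add_two_mul hp, planeTransversal_dispersion_add hp]

/-! ### 2. The plane identity -/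

/-- **Plane identity.** For `ω₂ ≥ 0` and all `k₁, k₂` (`ωⱼ = ω(kⱼ)`, `Ω₀ = ω₂ + 2`):
`sin((k₂−k₁)/2) · [(2ω₁ω₂ + 2Ω₀) cos((k₁+k₂)/2) − 4 cos((k₂−k₁)/2)] = (ω₁ sin k₂ − ω₂ sin k₁)(ω₁ + ω₂)`
(pure algebra from `ω² = Ω₀ − 2cos k`, `sin k₂ − sin k₁ = 2cos((k₁+k₂)/2) sin((k₂−k₁)/2)` and
`sin(k₂ − k₁) = 2 sin((k₂−k₁)/2) cos((k₂−k₁)/2)`). The bracket is the sheet function `H` on the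
exchange plane `k₃ = k₁`; so there `H = 0` forces equal velocities `v(k₁) = v(k₂)`. [folklore] -/
theorem planeTransversal_identity {ω₂ : ℝ} (hω : 0 ≤ ω₂) (k₁ k₂ : ℝ) :
    Real.sin ((k₂ - k₁) / 2) *
        ((2 * (dispersion ω₂ k₁ * dispersion ω₂ k₂) + 2 * (ω₂ + 2)) * Real.cos ((k₁ + k₂) / 2) -
          4 * Real.cos ((k₂ - k₁) / 2)) =
      (dispersion ω₂ k₁ * Real.sin k₂ - dispersion ω₂ k₂ * Real.sin k₁) *
        (dispersion ω₂ k₁ + dispersion ω₂ k₂) := by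
  have e₁ : (k₁ + k₂) / 2 - (k₂ - k₁) / 2 = k₁ := by ring
  have e₂ : (k₁ + k₂) / 2 + (k₂ - k₁) / 2 = k₂ := by ring
  have h1 : Real.sin ((k₁ + k₂) / 2 + (k₂ - k₁) / 2) - Real.sin ((k₁ + k₂) / 2 - (k₂ - k₁) / 2) =
      2 * Real.cos ((k₁ + k₂) / 2) * Real.sin ((k₂ - k₁) / 2) := by
    rw [Real.sin_add, Real.sin_sub]; ring
  rw [e₁, e₂] at h1
  have h2 : Real.sin (k₂ - k₁) = 2 * Real.sin ((k₂ - k₁) / 2) * Real.cos ((k₂ - k₁) / 2) := by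
    rw [← Real.sin_two_mul]; congr 1; ring
  rw [Real.sin_sub] at h2
  have hw₁ := dispersion_sq' hω k₁
  have hw₂ := dispersion_sq' hω k₂
  linear_combination (-Real.sin k₂) * hw₁ + Real.sin k₁ * hw₂ +
    (-(ω₂ + 2) - dispersion ω₂ k₁ * dispersion ω₂ k₂) * h1 + 2 * h2

/-! ### 3. The two reduced configurations -/

/-- **Exchange plane `k₂ ≡ k₃`** (variables `k₁, k₃`): if `(2ω₁ω₃ + 2Ω₀) cos((k₁+k₃)/2) − 4cos((k₃−k₁)/2) = 0`
then `(ω₁v₃ + ω₃v₁) cos((k₁+k₃)/2) − (ω₁ω₃ + Ω₀) sin((k₁+k₃)/2) ≠ 0`. By the plane identity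
`ω₁v₃ = sin k₁`, `ω₃v₁ = sin k₃` (the fold curve `v₁ = v₃`), so the expression is
`sin((k₁+k₃)/2) · (2cos((k₁+k₃)/2) cos((k₃−k₁)/2) − ω₁ω₃ − Ω₀)`, whose second factor is
`cos k₁ + cos k₃ − ω₁ω₃ − Ω₀ < 0`; and `sin((k₁+k₃)/2) = 0` would turn the hypothesis into
`(ω₁ω₃ + Ω₀)² = 4cos²((k₃−k₁)/2) ≤ 4`. (No hypothesis `k₃ ≢ k₁`: the triple diagonal is included.)
[folklore] -/
theorem planeTransversal_exch₂₃ {ω₂ : ℝ} (hω : 0 < ω₂) (k₁ k₃ : ℝ)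
    (hH : (2 * (dispersion ω₂ k₁ * dispersion ω₂ k₃) + 2 * (ω₂ + 2)) * Real.cos ((k₁ + k₃) / 2) -
        4 * Real.cos ((k₃ - k₁) / 2) = 0) :
    (dispersion ω₂ k₁ * groupVelocity ω₂ k₃ + dispersion ω₂ k₃ * groupVelocity ω₂ k₁) *
          Real.cos ((k₁ + k₃) / 2) -
        (dispersion ω₂ k₁ * dispersion ω₂ k₃ + (ω₂ + 2)) * Real.sin ((k₁ + k₃) / 2) ≠ 0 := by
  have hω₁ := dispersion_pos hω k₁
  have hω₃ := dispersion_pos hω k₃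
  -- the fold curve: equal velocities
  have hP := planeTransversal_identity hω.le k₁ k₃
  rw [hH, mul_zero] at hP
  have hE : dispersion ω₂ k₁ * Real.sin k₃ = dispersion ω₂ k₃ * Real.sin k₁ := by
    have := (mul_eq_zero.1 hP.symm).resolve_right (add_pos hω₁ hω₃).ne'
    linarith
  have hv₃ : dispersion ω₂ k₁ * groupVelocity ω₂ k₃ = Real.sin k₁ := by
    unfold groupVelocity
    rw [mul_div_assoc', div_eq_iff hω₃.ne', hE, mul_comm]
  have hv₁ : dispersion ω₂ k₃ * groupVelocity ω₂ k₁ = Real.sin k₃ := by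
    unfold groupVelocity
    rw [mul_div_assoc', div_eq_iff hω₁.ne', ← hE, mul_comm]
  -- half-angle identities
  have e₁ : (k₁ + k₃) / 2 - (k₃ - k₁) / 2 = k₁ := by ring
  have e₃ : (k₁ + k₃) / 2 + (k₃ - k₁) / 2 = k₃ := by ring
  have h5 : Real.sin ((k₁ + k₃) / 2 - (k₃ - k₁) / 2) + Real.sin ((k₁ + k₃) / 2 + (k₃ - k₁) / 2) =
      2 * Real.sin ((k₁ + k₃) / 2) * Real.cos ((k₃ - k₁) / 2) := by
    rw [Real.sin_add, Real.sin_sub]; ring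
  have h6 : Real.cos ((k₁ + k₃) / 2 - (k₃ - k₁) / 2) + Real.cos ((k₁ + k₃) / 2 + (k₃ - k₁) / 2) =
      2 * Real.cos ((k₁ + k₃) / 2) * Real.cos ((k₃ - k₁) / 2) := by
    rw [Real.cos_add, Real.cos_sub]; ring
  rw [e₁, e₃] at h5 h6
  intro hG
  have key : Real.sin ((k₁ + k₃) / 2) *
      (2 * Real.cos ((k₁ + k₃) / 2) * Real.cos ((k₃ - k₁) / 2) -
        (dispersion ω₂ k₁ * dispersion ω₂ k₃ + (ω₂ + 2))) = 0 := by
    linear_combination hG - Real.cos ((k₁ + k₃) / 2) * hv₃ - Real.cos ((k₁ + k₃) / 2) * hv₁ -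
      Real.cos ((k₁ + k₃) / 2) * h5
  rcases mul_eq_zero.1 key with hs | hM
  · -- `sin A′ = 0`: `cos² A′ = 1` and `H = 0` gives `(ω₁ω₃ + Ω₀)² = 4cos² B′ ≤ 4`
    have hc2 : Real.cos ((k₁ + k₃) / 2) ^ 2 = 1 := planeTransversal_cos_sq hs
    have h7 : ((dispersion ω₂ k₁ * dispersion ω₂ k₃ + (ω₂ + 2)) * Real.cos ((k₁ + k₃) / 2)) ^ 2 =
        4 * Real.cos ((k₃ - k₁) / 2) ^ 2 := by
      have h8 : (dispersion ω₂ k₁ * dispersion ω₂ k₃ + (ω₂ + 2)) * Real.cos ((k₁ + k₃) / 2) =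
          2 * Real.cos ((k₃ - k₁) / 2) := by
        linear_combination (1 / 2 : ℝ) * hH
      rw [h8]; ring
    rw [mul_pow, hc2, mul_one] at h7
    have := Real.cos_sq_le_one ((k₃ - k₁) / 2)
    have := mul_pos hω₁ hω₃
    nlinarith [sq_nonneg (dispersion ω₂ k₁ * dispersion ω₂ k₃ + (ω₂ + 2) - 2)]
  · -- `2cos A′ cos B′ = cos k₁ + cos k₃ ≤ 2 < ω₁ω₃ + Ω₀`
    have := Real.cos_le_one k₁
    have := Real.cos_le_one k₃
    have := mul_pos hω₁ hω₃
    linarith [sub_eq_zero.1 hM]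

/-- **Exchange plane `k₃ ≡ k₁`, off the diagonal** (variables `k₁, k₂`, `sin((k₂−k₁)/2) ≠ 0`): if
`(2ω₁ω₂ + 2Ω₀) cos((k₁+k₂)/2) − 4cos((k₂−k₁)/2) = 0` then
`2ω₁v₂ cos((k₁+k₂)/2) − (ω₁ω₂ + Ω₀) sin((k₁+k₂)/2) + 2 sin((k₂−k₁)/2) ≠ 0`. By the plane identity the
hypothesis gives `ω₁ sin k₂ = ω₂ sin k₁` (`ω₁v₂ = sin k₁`), and then
`2 sin((k₂−k₁)/2) · G = (cos k₁ − cos k₂)(2cos k₁ − ω₁ω₂ − Ω₀)`; the second factor is negative, and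
`cos k₁ = cos k₂` would give `ω₁ = ω₂`, `sin k₁ = sin k₂`, `2sin²((k₂−k₁)/2) = 1 − cos(k₂−k₁) = 0`.
[folklore] -/
theorem planeTransversal_exch₁₃_off {ω₂ : ℝ} (hω : 0 < ω₂) (k₁ k₂ : ℝ)
    (hB : Real.sin ((k₂ - k₁) / 2) ≠ 0)
    (hH : (2 * (dispersion ω₂ k₁ * dispersion ω₂ k₂) + 2 * (ω₂ + 2)) * Real.cos ((k₁ + k₂) / 2) -
        4 * Real.cos ((k₂ - k₁) / 2) = 0) :
    2 * (dispersion ω₂ k₁ * groupVelocity ω₂ k₂) * Real.cos ((k₁ + k₂) / 2) -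
          (dispersion ω₂ k₁ * dispersion ω₂ k₂ + (ω₂ + 2)) * Real.sin ((k₁ + k₂) / 2) +
        2 * Real.sin ((k₂ - k₁) / 2) ≠ 0 := by
  have hω₁ := dispersion_pos hω k₁
  have hω₂' := dispersion_pos hω k₂
  -- equal velocities on the plane
  have hP := planeTransversal_identity hω.le k₁ k₂
  rw [hH, mul_zero] at hP
  have hE : dispersion ω₂ k₁ * Real.sin k₂ = dispersion ω₂ k₂ * Real.sin k₁ := by
    have := (mul_eq_zero.1 hP.symm).resolve_right (add_pos hω₁ hω₂').ne'
    linarith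
  have hv : dispersion ω₂ k₁ * groupVelocity ω₂ k₂ = Real.sin k₁ := by
    unfold groupVelocity
    rw [mul_div_assoc', div_eq_iff hω₂'.ne', hE, mul_comm]
  -- half-angle identities
  have e₁ : (k₁ + k₂) / 2 - (k₂ - k₁) / 2 = k₁ := by ring
  have e₂ : (k₁ + k₂) / 2 + (k₂ - k₁) / 2 = k₂ := by ring
  have e₃ : 2 * ((k₂ - k₁) / 2) = k₂ - k₁ := by ring
  have h1 : Real.sin ((k₁ + k₂) / 2 + (k₂ - k₁) / 2) - Real.sin ((k₁ + k₂) / 2 - (k₂ - k₁) / 2) =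
      2 * Real.cos ((k₁ + k₂) / 2) * Real.sin ((k₂ - k₁) / 2) := by
    rw [Real.sin_add, Real.sin_sub]; ring
  have h3 : Real.cos ((k₁ + k₂) / 2 - (k₂ - k₁) / 2) - Real.cos ((k₁ + k₂) / 2 + (k₂ - k₁) / 2) =
      2 * Real.sin ((k₁ + k₂) / 2) * Real.sin ((k₂ - k₁) / 2) := by
    rw [Real.cos_add, Real.cos_sub]; ring
  rw [e₁, e₂] at h1 h3
  have h4 : 1 - Real.cos (2 * ((k₂ - k₁) / 2)) = 2 * Real.sin ((k₂ - k₁) / 2) ^ 2 := by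
    rw [Real.cos_two_mul, Real.cos_sq']; ring
  rw [e₃, Real.cos_sub] at h4
  have hp₁ := Real.sin_sq_add_cos_sq k₁
  intro hG
  have key : (Real.cos k₁ - Real.cos k₂) *
      (2 * Real.cos k₁ - (dispersion ω₂ k₁ * dispersion ω₂ k₂ + (ω₂ + 2))) = 0 := by
    linear_combination (2 * Real.sin ((k₂ - k₁) / 2)) * hG -
      (4 * Real.cos ((k₁ + k₂) / 2) * Real.sin ((k₂ - k₁) / 2)) * hv + (2 * Real.sin k₁) * h1 -
      (dispersion ω₂ k₁ * dispersion ω₂ k₂ + (ω₂ + 2)) * h3 + 2 * h4 + 2 * hp₁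
  rcases mul_eq_zero.1 key with hc | hM
  · -- `cos k₁ = cos k₂`: then `ω₁ = ω₂`, `sin k₁ = sin k₂`, `k₁ ≡ k₂`
    have hc' : Real.cos k₁ = Real.cos k₂ := sub_eq_zero.1 hc
    have hω12 : dispersion ω₂ k₁ = dispersion ω₂ k₂ := by
      unfold dispersion
      rw [hc']
    rw [hω12] at hE
    have hs' : Real.sin k₂ = Real.sin k₁ := mul_left_cancel₀ hω₂'.ne' hE
    rw [hs', ← hc'] at h4
    apply hB
    have : Real.sin ((k₂ - k₁) / 2) ^ 2 = 0 := by
      linear_combination (-1 / 2 : ℝ) * hp₁ - (1 / 2 : ℝ) * h4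
    exact pow_eq_zero_iff two_ne_zero |>.1 this
  · -- `2cos k₁ = ω₁ω₂ + Ω₀ > 2`
    have := mul_pos hω₁ hω₂'
    have := Real.cos_le_one k₁
    linarith [sub_eq_zero.1 hM]

/-- **Exchange plane `k₃ ≡ k₁`** (variables `k₁, k₂`): if `(2ω₁ω₂ + 2Ω₀) cos((k₁+k₂)/2) − 4cos((k₂−k₁)/2) = 0`
then `2ω₁v₂ cos((k₁+k₂)/2) − (ω₁ω₂ + Ω₀) sin((k₁+k₂)/2) + 2 sin((k₂−k₁)/2) ≠ 0` (off the diagonal by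
`planeTransversal_exch₁₃_off`; on it, `k₂ = k₁ + 2B` with `sin B = 0`, so `ω₂ = ω₁`, `v₂ = v₁` and the
claim is `planeTransversal_exch₂₃` at `(k₁, k₂)`). [folklore] -/
theorem planeTransversal_exch₁₃ {ω₂ : ℝ} (hω : 0 < ω₂) (k₁ k₂ : ℝ)
    (hH : (2 * (dispersion ω₂ k₁ * dispersion ω₂ k₂) + 2 * (ω₂ + 2)) * Real.cos ((k₁ + k₂) / 2) -
        4 * Real.cos ((k₂ - k₁) / 2) = 0) :
    2 * (dispersion ω₂ k₁ * groupVelocity ω₂ k₂) * Real.cos ((k₁ + k₂) / 2) -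
          (dispersion ω₂ k₁ * dispersion ω₂ k₂ + (ω₂ + 2)) * Real.sin ((k₁ + k₂) / 2) +
        2 * Real.sin ((k₂ - k₁) / 2) ≠ 0 := by
  by_cases hB : Real.sin ((k₂ - k₁) / 2) = 0
  · have hG' := planeTransversal_exch₂₃ hω k₁ k₂ hH
    have e₂ : k₁ + 2 * ((k₂ - k₁) / 2) = k₂ := by ring
    have hω₂' := planeTransversal_dispersion_add hB ω₂ k₁
    have hv₂ := planeTransversal_groupVelocity_add hB ω₂ k₁
    rw [e₂] at hω₂' hv₂
    rw [hω₂', hv₂] at hG' ⊢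
    rw [hB]
    intro hG
    apply hG'
    linear_combination hG
  · exact planeTransversal_exch₁₃_off hω k₁ k₂ hB hH

/-! ### 4. The stub -/

/-- **STUB TB — transversality of the collision sheet on the exchange planes** (line
`swap-odd-threshold-rigidity`, crux `EmbeddedDrudeMourre.MourreDissolution`). For `ω₂ > 0` and real
`k₁, k₂, k₃` (`k₄ = k₁+k₂−k₃`, `ωⱼ = ω(kⱼ)`, `vⱼ = v(kⱼ)`, `Ω₀ = ω₂ + 2`): at a common zero of the sheet
function `H = (ω₁ω₂ + ω₃ω₄ + 2Ω₀) cos((k₁+k₂)/2) − 4cos((k₃−k₁)/2) cos((k₂−k₃)/2)` and of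
`sin((k₃−k₁)/2) sin((k₂−k₃)/2)` (the exchange planes `k₃ ≡ k₁`, `k₂ ≡ k₃` mod `2π`), the `k₂`-derivative
`G = (ω₁v₂ + ω₃v₄) cos((k₁+k₂)/2) − ½(ω₁ω₂ + ω₃ω₄ + 2Ω₀) sin((k₁+k₂)/2) + 2cos((k₃−k₁)/2) sin((k₂−k₃)/2)`
does not vanish. Reduction to `planeTransversal_exch₁₃` / `planeTransversal_exch₂₃` by the shift lemmas
of §1 (`sin p = 0`, `p = (k₃−k₁)/2` resp. `(k₂−k₃)/2`). [folklore] -/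
theorem stub_planeTransversal :
    ∀ ω₂ : ℝ, 0 < ω₂ → ∀ k₁ k₂ k₃ : ℝ,
      ((dispersion ω₂ k₁ * dispersion ω₂ k₂ + dispersion ω₂ k₃ * dispersion ω₂ (k₁ + k₂ - k₃) +
              2 * (ω₂ + 2)) * Real.cos ((k₁ + k₂) / 2) -
          4 * Real.cos ((k₃ - k₁) / 2) * Real.cos ((k₂ - k₃) / 2)) = 0 →
      Real.sin ((k₃ - k₁) / 2) * Real.sin ((k₂ - k₃) / 2) = 0 →
      ((dispersion ω₂ k₁ * groupVelocity ω₂ k₂ + dispersion ω₂ k₃ * groupVelocity ω₂ (k₁ + k₂ - k₃)) *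
              Real.cos ((k₁ + k₂) / 2) -
            1 / 2 * (dispersion ω₂ k₁ * dispersion ω₂ k₂ + dispersion ω₂ k₃ * dispersion ω₂ (k₁ + k₂ - k₃) +
              2 * (ω₂ + 2)) * Real.sin ((k₁ + k₂) / 2) +
          2 * Real.cos ((k₃ - k₁) / 2) * Real.sin ((k₂ - k₃) / 2)) ≠ 0 := by
  intro ω₂ hω k₁ k₂ k₃ hH hS
  rcases mul_eq_zero.1 hS with hp | hq
  · -- the plane `k₃ ≡ k₁`: `p = (k₃ − k₁)/2`, `sin p = 0`, `k₃ = k₁ + 2p`, `k₄ = k₂ − 2p`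
    have e₃ : k₁ + 2 * ((k₃ - k₁) / 2) = k₃ := by ring
    have e₄ : (k₁ + k₂ - k₃) + 2 * ((k₃ - k₁) / 2) = k₂ := by ring
    have eB : (k₂ - k₃) / 2 + (k₃ - k₁) / 2 = (k₂ - k₁) / 2 := by ring
    have hω₃ := planeTransversal_dispersion_add hp ω₂ k₁
    have hω₄ := planeTransversal_dispersion_add hp ω₂ (k₁ + k₂ - k₃)
    have hv₄ := planeTransversal_groupVelocity_add hp ω₂ (k₁ + k₂ - k₃)
    have hcB := planeTransversal_cos_add hp ((k₂ - k₃) / 2)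
    have hsB := planeTransversal_sin_add hp ((k₂ - k₃) / 2)
    rw [e₃] at hω₃
    rw [e₄] at hω₄ hv₄
    rw [eB] at hcB hsB
    rw [hω₃, ← hω₄] at hH
    have hH' : (2 * (dispersion ω₂ k₁ * dispersion ω₂ k₂) + 2 * (ω₂ + 2)) * Real.cos ((k₁ + k₂) / 2) -
        4 * Real.cos ((k₂ - k₁) / 2) = 0 := by
      rw [hcB]
      linear_combination hH
    have hG' := planeTransversal_exch₁₃ hω k₁ k₂ hH'
    rw [hsB] at hG'
    rw [hω₃, ← hω₄, ← hv₄]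
    intro hG
    apply hG'
    linear_combination hG
  · -- the plane `k₂ ≡ k₃`: `q = (k₂ − k₃)/2`, `sin q = 0`, `k₂ = k₃ + 2q`, `k₄ = k₁ + 2q`
    have e₂ : k₃ + 2 * ((k₂ - k₃) / 2) = k₂ := by ring
    have e₄ : k₁ + 2 * ((k₂ - k₃) / 2) = k₁ + k₂ - k₃ := by ring
    have eA : (k₁ + k₃) / 2 + (k₂ - k₃) / 2 = (k₁ + k₂) / 2 := by ring
    have hω₂' := planeTransversal_dispersion_add hq ω₂ k₃
    have hv₂ := planeTransversal_groupVelocity_add hq ω₂ k₃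
    have hω₄ := planeTransversal_dispersion_add hq ω₂ k₁
    have hv₄ := planeTransversal_groupVelocity_add hq ω₂ k₁
    have hcA := planeTransversal_cos_add hq ((k₁ + k₃) / 2)
    have hsA := planeTransversal_sin_add hq ((k₁ + k₃) / 2)
    rw [e₂] at hω₂' hv₂
    rw [e₄] at hω₄ hv₄
    rw [eA] at hcA hsA
    have hcq := planeTransversal_cos_ne_zero hq
    rw [hω₂', hω₄, hcA] at hH
    have hH' : (2 * (dispersion ω₂ k₁ * dispersion ω₂ k₃) + 2 * (ω₂ + 2)) * Real.cos ((k₁ + k₃) / 2) -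
        4 * Real.cos ((k₃ - k₁) / 2) = 0 := by
      have : Real.cos ((k₂ - k₃) / 2) *
          ((2 * (dispersion ω₂ k₁ * dispersion ω₂ k₃) + 2 * (ω₂ + 2)) * Real.cos ((k₁ + k₃) / 2) -
            4 * Real.cos ((k₃ - k₁) / 2)) = 0 := by
        linear_combination hH
      exact (mul_eq_zero.1 this).resolve_left hcq
    have hG' := planeTransversal_exch₂₃ hω k₁ k₃ hH'
    rw [hω₂', hω₄, hv₂, hv₄, hcA, hsA, hq]
    intro hG
    apply hG'
    have : Real.cos ((k₂ - k₃) / 2) *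
        ((dispersion ω₂ k₁ * groupVelocity ω₂ k₃ + dispersion ω₂ k₃ * groupVelocity ω₂ k₁) *
            Real.cos ((k₁ + k₃) / 2) -
          (dispersion ω₂ k₁ * dispersion ω₂ k₃ + (ω₂ + 2)) * Real.sin ((k₁ + k₃) / 2)) = 0 := by
      linear_combination hG
    exact (mul_eq_zero.1 this).resolve_left hcq

end Summit.AtomisticToContinuum.FouriersLaw.Theorems.MourreDissolution

end
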